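import Mathlib.LinearAlgebra.Matrix.Block
import Mathlib.Algebra.Order.Antidiag.FinsuppEquiv
import Mathlib.RingTheory.MvPolynomial.Homogeneous
import Literature.Barriers.ValiantsHypothesis.ShiftedPartialsDegenerations
import Literature.Barriers.ValiantsHypothesis.ShiftedPartialsMonotone
import Literature.Computability.AlgebraicComplexity.OrbitClosure
import HarnessLib

/-!
# Shifted partial derivatives: padded forms and two pure powers
(Efremenko–Landsberg–Schenck–Weyman 2018, §4–§5)

Support file for the barrier entry `ShiftedPartialDerivatives.lean` (`ShiftedPartialsCannotSeparate`,
ELSW Thm. 1.5), Cases C2/C3: the two rank estimates of §4–§5 that do not need Macaulay's theorem,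
and the degeneration of §5. Letters as in ELSW (`m` permanent size, `n` determinant size, order `k`,
shift `τ`, `N = n²` variables; `rank(P_{(k,n-k)[τ]})` = the tree's `shiftedPartialsRank K k τ P`).

* COUNTING (`card_filter_le_apply`, `card_filter_two_le`): monomials of degree `e + s` divisible by
  `x_a^s` ↔ monomials of degree `e`; those divisible by `x_a^s x_b^s` are at most `dim S^{d-2s}`.
* PERMANENT SIDE (§4, "(permesta)"): "As long as `k < n-m`, `I^{ℓ^{n-m}perm_m,k}_{n-k} ⊂ ℓ^{n-m-k}·S^mW`,
  so `dim I^{ℓ^{n-m}perm_m,k}_{n-k+τ} ≤ binom(n²+m+τ-1, m+τ)`." — proved for any padded form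
  `X i₀ ^ e · Q` via the `X i₀`-order filtration of `ShiftedPartialsMonotone.lean`
  (`shiftedPartialsRank_X_pow_mul_le`, `shiftedPartialsRank_paddedPerPoly_le_choose`), any field.
* DETERMINANT SIDE (§5): for `R = ℓ₁ⁿ + c ℓ₂ⁿ`, "`I^{R,k}_{n-k} = span{ℓ₁^{n-k}, ℓ₂^{n-k}}`. In degree
  `n-k+τ`, this ideal consists of all polynomials of the form `ℓ₁^{n-k}Q₁ + ℓ₂^{n-k}Q₂` ... which has
  dimension `2 dim S^τℂ^{n²} - dim S^{τ-(n-k)}ℂ^{n²}`" — the lower bound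
  `le_shiftedPartialsRank_two_powers` (characteristic zero, `0 < k ≤ n`).
* THE DEGENERATION (§5): "we simply degenerate `det_n` to `R = ℓ₁ⁿ+ℓ₂ⁿ` by e.g., setting all diagonal
  elements to `ℓ₁`, all the sub-diagonal elements to `ℓ₂` as well as the `(1,n)`-entry, and setting all
  other elements of the matrix to zero" — `aeval_circulant_detPoly` (transposed shape; the sign is
  `(-1)^{n+1}`, immaterial) and `X_pow_add_mem_endOrbit`.

## References

* [EfremenkoLandsbergSchenckWeyman2018] K. Efremenko, J. M. Landsberg, H. Schenck, J. Weyman,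
  *The method of shifted partial derivatives cannot separate the permanent from the determinant*,
  Math. Comp. 87 (2018) 2037–2045, §4 (Case C2, (permesta)) and §5 (Case C3).
-/

noncomputable section

namespace Literature.Barriers.ValiantsHypothesis

open MvPolynomial Literature.Computability.AlgebraicComplexity

/-! ### Counting monomials -/

section Counting

variable {σ : Type*} [Fintype σ] [DecidableEq σ]

/-- The monomials of degree `e + s` divisible by `X a ^ s` are the translates by `a^s` of the monomials of
degree `e`. [folklore] -/
theorem filter_le_apply_eq_image (a : σ) (e s : ℕ) :
    ((Finset.univ : Finset σ).finsuppAntidiag (e + s)).filter (fun μ : σ →₀ ℕ => s ≤ μ a) =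
      ((Finset.univ : Finset σ).finsuppAntidiag e).image fun ν => ν + Finsupp.single a s := by
  ext μ
  rw [Finset.mem_filter, Finset.mem_image, ← degree_eq_iff_mem_finsuppAntidiag]
  constructor
  · rintro ⟨hdeg, hs⟩
    have hle : Finsupp.single a s ≤ μ := Finsupp.single_le_iff.2 hs
    refine ⟨μ - Finsupp.single a s, ?_, tsub_add_cancel_of_le hle⟩
    rw [← degree_eq_iff_mem_finsuppAntidiag]
    have : (μ - Finsupp.single a s).degree + (Finsupp.single a s).degree = μ.degree := by
      rw [← map_add, tsub_add_cancel_of_le hle]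
    rw [Finsupp.degree_single] at this
    omega
  · rintro ⟨ν, hν, rfl⟩
    rw [← degree_eq_iff_mem_finsuppAntidiag] at hν
    refine ⟨?_, by simp⟩
    rw [map_add, Finsupp.degree_single, hν]

/-- Hence there are `dim S^e = binom(N + e - 1, e)` of them (`N` the number of variables). [folklore] -/
theorem card_filter_le_apply (a : σ) (e s : ℕ) :
    (((Finset.univ : Finset σ).finsuppAntidiag (e + s)).filter (fun μ : σ →₀ ℕ => s ≤ μ a)).card =
      (Fintype.card σ + e - 1).choose e := by
  rw [filter_le_apply_eq_image, Finset.card_image_of_injective _ (add_left_injective _),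
    Finset.card_finsuppAntidiag_nat_eq_choose, Finset.card_univ]

/-- `dim S^d = binom(N + d - 1, d)` monomials of degree `d` in `N` variables (Mathlib). [folklore] -/
theorem card_finsuppAntidiag_univ (d : ℕ) :
    ((Finset.univ : Finset σ).finsuppAntidiag d).card = (Fintype.card σ + d - 1).choose d := by
  rw [Finset.card_finsuppAntidiag_nat_eq_choose, Finset.card_univ]

/-- The monomials of degree `d` divisible by `X a ^ s X b ^ s` (`a ≠ b`) are at most `dim S^{d-2s}` in
number (the overlap `ℓ₁^{n-k}ℓ₂^{n-k}Q₃` in ELSW §5). [folklore] -/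
theorem card_filter_two_le {a b : σ} (hab : a ≠ b) (d s : ℕ) :
    (((Finset.univ : Finset σ).finsuppAntidiag d).filter
        (fun μ : σ →₀ ℕ => s ≤ μ a ∧ s ≤ μ b)).card ≤
      (Fintype.card σ + (d - s - s) - 1).choose (d - s - s) := by
  rw [← card_finsuppAntidiag_univ]
  refine (Finset.card_le_card (t := ((Finset.univ : Finset σ).finsuppAntidiag (d - s - s)).image
    fun ν => ν + Finsupp.single a s + Finsupp.single b s) ?_).trans Finset.card_image_le
  intro μ hμ
  rw [Finset.mem_filter, ← degree_eq_iff_mem_finsuppAntidiag] at hμ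
  obtain ⟨hdeg, ha, hb⟩ := hμ
  have hle : Finsupp.single a s + Finsupp.single b s ≤ μ := by
    intro v
    rw [Finsupp.add_apply, Finsupp.single_apply, Finsupp.single_apply]
    by_cases hva : a = v
    · subst hva; rw [if_pos rfl, if_neg hab.symm, add_zero]; exact ha
    · rw [if_neg hva, zero_add]
      split_ifs with hvb
      · subst hvb; exact hb
      · exact Nat.zero_le _
  rw [Finset.mem_image]
  refine ⟨μ - (Finsupp.single a s + Finsupp.single b s), ?_, ?_⟩
  · rw [← degree_eq_iff_mem_finsuppAntidiag]
    have : (μ - (Finsupp.single a s + Finsupp.single b s)).degree +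
        (Finsupp.single a s + Finsupp.single b s).degree = μ.degree := by
      rw [← map_add, tsub_add_cancel_of_le hle]
    rw [map_add, Finsupp.degree_single, Finsupp.degree_single] at this
    omega
  · rw [add_assoc, tsub_add_cancel_of_le hle]

end Counting

/-! ### The permanent side: padded polynomials -/

section Padded

variable {K : Type*} [Field K] {σ : Type*} [Fintype σ] [DecidableEq σ]

omit [Fintype σ] in
/-- The `X i₀`-order of a polynomial drops by at most one under a partial derivative. [folklore] -/
theorem pderiv_mem_orderFiltration {i₀ : σ} {D : ℕ} {p : MvPolynomial σ K}
    (hp : p ∈ restrictSupport K {β : σ →₀ ℕ | D ≤ β i₀}) (j : σ) :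
    pderiv j p ∈ restrictSupport K {β : σ →₀ ℕ | D - 1 ≤ β i₀} := by
  rw [mem_orderFiltration_iff] at hp ⊢
  intro γ hγ
  rw [coeff_pderiv] at hγ
  have := hp _ (left_ne_zero_of_mul hγ)
  rw [Finsupp.add_apply, Finsupp.single_apply] at this
  split_ifs at this <;> omega

omit [Fintype σ] in
/-- ... and by at most `|l|` under the iterated derivative along `l`. [folklore] -/
theorem iterPDeriv_mem_orderFiltration {i₀ : σ} {D : ℕ} {p : MvPolynomial σ K}
    (hp : p ∈ restrictSupport K {β : σ →₀ ℕ | D ≤ β i₀}) (l : List σ) :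
    iterPDeriv l p ∈ restrictSupport K {β : σ →₀ ℕ | D - l.length ≤ β i₀} := by
  induction l with
  | nil => simpa using hp
  | cons j l ih =>
    rw [iterPDeriv_cons, List.length_cons]
    have := pderiv_mem_orderFiltration ih j
    rwa [Nat.sub_sub] at this

omit [Fintype σ] [DecidableEq σ] in
/-- A monomial of `x^β · w` is `x^β` times a monomial of `w`. [folklore] -/
theorem le_and_mem_support_of_mem_support_monomial_mul (β : σ →₀ ℕ) (w : MvPolynomial σ K)
    {μ : σ →₀ ℕ} (hμ : μ ∈ (monomial β (1 : K) * w).support) : β ≤ μ ∧ (μ - β) ∈ w.support := by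
  rw [mem_support_iff, coeff_monomial_mul'] at hμ
  split_ifs at hμ with hle
  · rw [one_mul] at hμ
    exact ⟨hle, mem_support_iff.2 hμ⟩
  · exact (hμ rfl).elim

/-- **Permanent-side bound (ELSW §4, (permesta))**: for `k ≤ e` the order-`k` shifted partials of shift
`τ` of a padded form `X i₀ ^ e · Q`, `Q` a form of degree `d_Q`, are multiples of `X i₀ ^ (e - k)` of
degree `e - k + d_Q + τ`, so they span a space of dimension at most `dim S^{d_Q + τ} = binom(N + d_Q + τ - 1, d_Q + τ)`
("As long as `k < n - m`, `I^{ℓ^{n-m}perm_m,k}_{n-k} ⊂ ℓ^{n-m-k} · S^mW`, so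
`dim I^{ℓ^{n-m}perm_m,k}_{n-k+τ} ≤ binom(n²+m+τ-1, m+τ)`"). [cite: EfremenkoLandsbergSchenckWeyman2018, §4 (permesta)] -/
theorem shiftedPartialsRank_X_pow_mul_le (i₀ : σ) (e dQ : ℕ) {Q : MvPolynomial σ K}
    (hQ : Q.IsHomogeneous dQ) (k τ : ℕ) (hk : k ≤ e) :
    shiftedPartialsRank K k τ (X i₀ ^ e * Q) ≤ (Fintype.card σ + (dQ + τ) - 1).choose (dQ + τ) := by
  classical
  set T := ((Finset.univ : Finset σ).finsuppAntidiag ((dQ + τ) + (e - k))).filter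
    (fun μ : σ →₀ ℕ => e - k ≤ μ i₀) with hT
  rw [← card_filter_le_apply i₀ (dQ + τ) (e - k), ← hT, ← finrank_restrictSupport (K := K) T]
  haveI := finite_restrictSupport (K := K) T
  unfold shiftedPartialsRank
  apply Submodule.finrank_mono
  rw [Submodule.span_le]
  rintro _ ⟨l, β, hl, hβ, rfl⟩
  rw [SetLike.mem_coe, mem_restrictSupport_iff]
  intro μ hμ
  have hP : (X i₀ ^ e * Q : MvPolynomial σ K).IsHomogeneous (e + dQ) :=
    (isHomogeneous_X_pow _ _).mul hQ
  have hw : (iterPDeriv l (X i₀ ^ e * Q)).IsHomogeneous (e + dQ - k) :=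
    hl ▸ isHomogeneous_iterPDeriv hP l
  have hord : iterPDeriv l (X i₀ ^ e * Q) ∈ restrictSupport K {β : σ →₀ ℕ | e - k ≤ β i₀} := by
    have h0 : (X i₀ ^ e * Q : MvPolynomial σ K) ∈ restrictSupport K {β : σ →₀ ℕ | e ≤ β i₀} := by
      have := monomial_mul_mem_orderFiltration (K := K) i₀ (Finsupp.single i₀ e) Q
      rwa [Finsupp.single_eq_same, ← X_pow_eq_monomial] at this
    have := iterPDeriv_mem_orderFiltration h0 l
    rwa [hl] at this
  obtain ⟨hle, hγ⟩ := le_and_mem_support_of_mem_support_monomial_mul β _ (Finset.mem_coe.1 hμ)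
  have hdegγ : (μ - β).degree = e + dQ - k := by
    have := hw (mem_support_iff.1 hγ)
    rwa [Finsupp.degree_eq_weight_one]
  have hordγ : e - k ≤ (μ - β) i₀ := (mem_orderFiltration_iff.1 hord) _ (mem_support_iff.1 hγ)
  rw [Finset.mem_coe, hT, Finset.mem_filter, ← degree_eq_iff_mem_finsuppAntidiag]
  constructor
  · have : μ = β + (μ - β) := (add_tsub_cancel_of_le hle).symm
    rw [this, map_add, hβ, hdegγ]
    omega
  · rw [Finsupp.tsub_apply] at hordγ
    omega

/-- The padded permanent instance of the bound: for `k + m ≤ n`,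
`rank((ℓ^{n-m} perm_m)_{(k,n-k)[τ]}) ≤ dim S^{m+τ}ℂ^{n²} = binom(n² + m + τ - 1, m + τ)`; ELSW state it
for `k < n - m`, the boundary case `k = n - m` holds by the same argument. [cite: EfremenkoLandsbergSchenckWeyman2018, §4 (permesta)] -/
theorem shiftedPartialsRank_paddedPerPoly_le_choose {m n : ℕ} [NeZero n] (hmn : m ≤ n) (k τ : ℕ)
    (hk : k + m ≤ n) :
    shiftedPartialsRank K k τ (paddedPerPoly K m n) ≤ (n ^ 2 + (m + τ) - 1).choose (m + τ) := by
  have hQ : (rename (fun ij : BlockIdx m n × BlockIdx m n => ((ij.1 : Fin n), (ij.2 : Fin n)))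
      (perPoly (BlockIdx m n) K)).IsHomogeneous m := by
    have := (perPoly_isHomogeneous (n := BlockIdx m n) (k := K)).rename_isHomogeneous
      (f := fun ij : BlockIdx m n × BlockIdx m n => ((ij.1 : Fin n), (ij.2 : Fin n)))
    rwa [card_blockIdx hmn] at this
  have := shiftedPartialsRank_X_pow_mul_le (K := K) ((0 : Fin n), (0 : Fin n)) (n - m) m hQ k τ
    (by omega)
  rw [Fintype.card_prod, Fintype.card_fin, ← sq] at this
  exact this

end Padded

/-! ### The determinant side: two pure powers -/

section TwoPowers

variable {K : Type*} [Field K] {σ : Type*} [DecidableEq σ]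

omit [DecidableEq σ] in
/-- `∂_a^j (X a ^ n) = n(n-1)⋯(n-j+1) X a ^ (n-j)`. [folklore] -/
theorem iterPDeriv_replicate_X_pow (a : σ) (n j : ℕ) :
    iterPDeriv (List.replicate j a) ((X a : MvPolynomial σ K) ^ n) =
      (n.descFactorial j : K) • X a ^ (n - j) := by
  induction j with
  | zero => simp
  | succ j ih =>
    rw [List.replicate_succ, iterPDeriv_cons, ih, Derivation.map_smul, Derivation.leibniz_pow, pderiv_X_self,
      smul_eq_mul, mul_one, ← Nat.cast_smul_eq_nsmul K, smul_smul, Nat.descFactorial_succ,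
      Nat.cast_mul, mul_comm, Nat.sub_sub]

omit [DecidableEq σ] in
/-- `∂_a^j p = 0` for `j ≥ 1` if `a` does not occur in `p`. [folklore] -/
theorem iterPDeriv_replicate_eq_zero {a : σ} {p : MvPolynomial σ K} (ha : a ∉ p.vars) {j : ℕ}
    (hj : 0 < j) : iterPDeriv (List.replicate j a) p = 0 := by
  obtain ⟨j, rfl⟩ := Nat.exists_eq_succ_of_ne_zero hj.ne'
  rw [List.replicate_succ', iterPDeriv_append]
  change iterPDeriv (List.replicate j a) (pderiv a p) = 0
  rw [pderiv_eq_zero_of_notMem_vars ha, iterPDeriv_zero']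

omit [DecidableEq σ] in
/-- In characteristic zero the span of the order-`k` shifted partials of shift `τ` of `c_u ℓ_uⁿ + c_v ℓ_vⁿ`
(`ℓ_u ≠ ℓ_v` variables, `c_u ≠ 0`, `0 < k ≤ n`) contains every monomial of degree `τ + (n - k)` divisible by
`ℓ_u^{n-k}` (`∂_u^k` of the form is a nonzero multiple of `ℓ_u^{n-k}`): ELSW §5, "`I^{R,k}_{n-k} = span{ℓ₁^{n-k}, ℓ₂^{n-k}}`".
[cite: EfremenkoLandsbergSchenckWeyman2018, §5] -/
theorem monomial_mem_span_shiftedPartials_two_powers [CharZero K] {u v : σ} (huv : u ≠ v)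
    {cu cv : K} (hcu : cu ≠ 0) (n k τ : ℕ) (hk0 : 0 < k) (hkn : k ≤ n) {μ : σ →₀ ℕ}
    (hμ : μ.degree = τ + (n - k)) (hu : n - k ≤ μ u) :
    monomial μ (1 : K) ∈ Submodule.span K
      (shiftedPartials k τ (cu • (X u : MvPolynomial σ K) ^ n + cv • X v ^ n)) := by
  set s := n - k with hs
  set C : K := (n.descFactorial k : K) with hC
  have hC0 : C ≠ 0 := by
    rw [hC, Nat.cast_ne_zero, Ne, Nat.descFactorial_eq_zero_iff_lt]
    omega
  have hder : iterPDeriv (List.replicate k u) (cu • (X u : MvPolynomial σ K) ^ n + cv • X v ^ n) =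
      (cu * C) • X u ^ s := by
    rw [iterPDeriv_add, iterPDeriv_smul, iterPDeriv_smul, iterPDeriv_replicate_X_pow,
      iterPDeriv_replicate_eq_zero _ hk0, smul_zero, add_zero, smul_smul]
    intro h
    have := vars_pow _ _ h
    rw [vars_X, Finset.mem_singleton] at this
    exact huv this
  have hle : Finsupp.single u s ≤ μ := Finsupp.single_le_iff.2 hu
  have hmono : monomial μ (1 : K) = (cu * C)⁻¹ • (monomial (μ - Finsupp.single u s) (1 : K) *
      iterPDeriv (List.replicate k u) (cu • (X u : MvPolynomial σ K) ^ n + cv • X v ^ n)) := by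
    rw [hder, mul_smul_comm, smul_smul, inv_mul_cancel₀ (mul_ne_zero hcu hC0), one_smul,
      X_pow_eq_monomial, monomial_mul, one_mul, tsub_add_cancel_of_le hle]
  rw [hmono]
  refine Submodule.smul_mem _ _ (Submodule.subset_span ⟨List.replicate k u, μ - Finsupp.single u s,
    List.length_replicate, ?_, rfl⟩)
  have : (μ - Finsupp.single u s).degree + (Finsupp.single u s).degree = μ.degree := by
    rw [← map_add, tsub_add_cancel_of_le hle]
  rw [Finsupp.degree_single, hμ] at this
  omega

/-- **Determinant-side bound of Case C3 (ELSW §5)**: in characteristic zero, for variables `a ≠ b`, `c ≠ 0`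
and `0 < k ≤ n`: `rank((ℓ_aⁿ + c ℓ_bⁿ)_{(k,n-k)[τ]}) ≥ 2 dim S^τ - dim S^{τ-(n-k)}` (with `N` variables,
`2 binom(N+τ-1, τ) - binom(N+τ-(n-k)-1, τ-(n-k))`; for `τ < n - k` the subtracted term is the harmless junk
value `binom(N-1, 0) = 1`): "In degree `n-k+τ`, this ideal consists of all polynomials of the form
`ℓ₁^{n-k}Q₁ + ℓ₂^{n-k}Q₂` with `Q₁, Q₂ ∈ S^τℂ^{n²}`, which has dimension `2 dim S^τℂ^{n²} - dim S^{τ-(n-k)}ℂ^{n²}`".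
ELSW state the equality; the inequality is what is used. [cite: EfremenkoLandsbergSchenckWeyman2018, §5 (Case C3)] -/
theorem le_shiftedPartialsRank_two_powers [Fintype σ] [CharZero K] {a b : σ} (hab : a ≠ b) {c : K} (hc : c ≠ 0)
    (n k τ : ℕ) (hk0 : 0 < k) (hkn : k ≤ n) :
    2 * (Fintype.card σ + τ - 1).choose τ -
        (Fintype.card σ + (τ - (n - k)) - 1).choose (τ - (n - k)) ≤
      shiftedPartialsRank K k τ ((X a : MvPolynomial σ K) ^ n + c • X b ^ n) := by
  classical
  set s := n - k with hs
  set R : MvPolynomial σ K := X a ^ n + c • X b ^ n with hR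
  set A := ((Finset.univ : Finset σ).finsuppAntidiag (τ + s)).filter (fun μ : σ →₀ ℕ => s ≤ μ a)
    with hA
  set B := ((Finset.univ : Finset σ).finsuppAntidiag (τ + s)).filter (fun μ : σ →₀ ℕ => s ≤ μ b)
    with hB
  have hkey : restrictSupport K (↑(A ∪ B) : Set (σ →₀ ℕ)) ≤ Submodule.span K (shiftedPartials k τ R) := by
    rw [restrictSupport_eq_span, Submodule.span_le]
    rintro _ ⟨μ, hμ, rfl⟩
    rw [Finset.mem_coe, Finset.mem_union, hA, hB, Finset.mem_filter, Finset.mem_filter,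
      ← degree_eq_iff_mem_finsuppAntidiag] at hμ
    show monomial μ (1 : K) ∈ _
    rcases hμ with ⟨hdeg, h⟩ | ⟨hdeg, h⟩
    · have := monomial_mem_span_shiftedPartials_two_powers (K := K) hab (cu := 1) (cv := c)
        one_ne_zero n k τ hk0 hkn hdeg h
      rwa [one_smul] at this
    · have := monomial_mem_span_shiftedPartials_two_powers (K := K) (Ne.symm hab) (cu := c)
        (cv := 1) hc n k τ hk0 hkn hdeg h
      rwa [one_smul, add_comm] at this
  haveI := finite_span_shiftedPartials (K := K) k τ R
  have h1 := Submodule.finrank_mono hkey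
  rw [finrank_restrictSupport] at h1
  have hAc : A.card = (Fintype.card σ + τ - 1).choose τ := card_filter_le_apply a τ s
  have hBc : B.card = (Fintype.card σ + τ - 1).choose τ := card_filter_le_apply b τ s
  have hAB : (A ∩ B).card ≤ (Fintype.card σ + (τ - s) - 1).choose (τ - s) := by
    have := card_filter_two_le hab (τ + s) s
    rw [Finset.filter_and, show τ + s - s - s = τ - s by omega] at this
    exact this
  have hunion := Finset.card_union_add_card_inter A B
  unfold shiftedPartialsRank
  omega

end TwoPowers

/-! ### The circulant degeneration `ℓ₁ⁿ ± ℓ₂ⁿ ∈ End(W) · det_n` -/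

section Circulant

variable {K : Type*} [Field K] {σ : Type*}

/-- **ELSW's degeneration of `det_n` to two pure powers** (§5: "we simply degenerate `det_n` to
`R = ℓ₁ⁿ + ℓ₂ⁿ` by e.g., setting all diagonal elements to `ℓ₁`, all the sub-diagonal elements to `ℓ₂` as
well as the `(1,n)`-entry, and setting all other elements of the matrix to zero"; here, transposed: `ℓ₂`
on the superdiagonal and at `(n,1)`): the substituted determinant is `ℓ₁ⁿ + (-1)^{n+1} ℓ₂ⁿ` for `n ≥ 2`
(Laplace expansion along the first column: an upper and a lower triangular minor).
[cite: EfremenkoLandsbergSchenckWeyman2018, §5 (Case C3)] -/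
theorem aeval_circulant_detPoly [DecidableEq σ] (a b : σ) (n : ℕ) (hn : 2 ≤ n) :
    aeval (fun ij : Fin n × Fin n =>
        ((if ij.2 = ij.1 then some a else if ij.2.val = ij.1.val + 1 then some b
          else if ij.1.val + 1 = n ∧ ij.2.val = 0 then some b else none).elim 0 X :
          MvPolynomial σ K))
        (Literature.Computability.AlgebraicComplexity.detPoly (Fin n) K) =
      X a ^ n + (-1) ^ (n + 1) * X b ^ n := by
  classical
  obtain ⟨n, rfl⟩ : ∃ n', n = n' + 2 := ⟨n - 2, by omega⟩
  set g : Fin (n + 2) × Fin (n + 2) → MvPolynomial σ K := fun ij =>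
    (if ij.2 = ij.1 then some a else if ij.2.val = ij.1.val + 1 then some b
      else if ij.1.val + 1 = n + 2 ∧ ij.2.val = 0 then some b else none).elim 0 X with hg
  set A : Matrix (Fin (n + 2)) (Fin (n + 2)) (MvPolynomial σ K) := Matrix.of fun i j => g (i, j)
    with hA
  have hmat : (aeval g).mapMatrix (Matrix.mvPolynomialX (Fin (n + 2)) (Fin (n + 2)) K) = A := by
    ext i j
    simp [hA, AlgHom.mapMatrix_apply, Matrix.map_apply, Matrix.mvPolynomialX_apply]
  rw [Literature.Computability.AlgebraicComplexity.detPoly, AlgHom.map_det, hmat,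
    Matrix.det_succ_column_zero, Fin.sum_univ_succ]
  -- entries of the first column
  have hcol : ∀ i : Fin (n + 1), A i.succ 0 = if i = Fin.last n then X b else 0 := by
    intro i
    simp only [hA, Matrix.of_apply, hg]
    have h1 : ¬ ((0 : Fin (n + 2)) = i.succ) := fun h => Fin.succ_ne_zero i h.symm
    have h2 : ¬ ((0 : Fin (n + 2)).val = i.succ.val + 1) := by simp
    rw [if_neg h1, if_neg h2]
    by_cases hi : i = Fin.last n
    · subst hi
      rw [if_pos ⟨by simp, rfl⟩, if_pos rfl]; rfl
    · rw [if_neg, if_neg hi]; · rfl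
      rintro ⟨h, -⟩
      apply hi
      apply Fin.ext
      rw [Fin.val_succ] at h
      simp only [Fin.val_last]
      omega
  have h00 : A 0 0 = X a := by simp [hA, hg]
  -- the two minors
  have hU : (A.submatrix (Fin.succAbove 0) Fin.succ).det = X a ^ (n + 1) := by
    rw [Fin.succAbove_zero, Matrix.det_of_upperTriangular]
    · have : ∀ i : Fin (n + 1), A i.succ i.succ = X a := fun i => by
        simp [hA, hg]
      simp [this, Finset.prod_const]
    · intro i j hij
      simp only [Matrix.submatrix_apply, hA, Matrix.of_apply, hg]
      have hij' : j.val < i.val := hij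
      rw [if_neg, if_neg, if_neg]; · rfl
      · rintro ⟨-, h⟩; simp at h
      · rw [Fin.val_succ, Fin.val_succ]; omega
      · intro h; rw [Fin.succ_inj] at h; subst h; exact lt_irrefl _ hij'
  have hL : (A.submatrix (Fin.succAbove (Fin.last (n + 1))) Fin.succ).det = X b ^ (n + 1) := by
    rw [Fin.succAbove_last, Matrix.det_of_lowerTriangular]
    · have : ∀ i : Fin (n + 1), A i.castSucc i.succ = X b := fun i => by
        simp only [hA, Matrix.of_apply, hg]
        rw [if_neg, if_pos]; · rfl
        · rw [Fin.val_succ, Fin.val_castSucc]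
        · intro h; have := congrArg Fin.val h; simp at this
      simp [this, Finset.prod_const]
    · intro i j hij
      simp only [Matrix.submatrix_apply, hA, Matrix.of_apply, hg]
      have hij' : i.val < j.val := hij
      rw [if_neg, if_neg, if_neg]; · rfl
      · rintro ⟨h, -⟩; rw [Fin.val_castSucc] at h; have := i.2; omega
      · rw [Fin.val_succ, Fin.val_castSucc]; omega
      · intro h; have := congrArg Fin.val h; rw [Fin.val_succ, Fin.val_castSucc] at this; omega
  rw [Finset.sum_eq_single (Fin.last n)]
  · rw [hcol, if_pos rfl, h00, Fin.succ_last, hL, hU]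
    simp only [Fin.val_zero, pow_zero, one_mul, Fin.val_last, Nat.succ_eq_add_one]
    ring
  · intro i _ hi
    rw [hcol, if_neg hi]; simp
  · intro h; exact (h (Finset.mem_univ _)).elim

/-- Hence `ℓ_aⁿ + (-1)^{n+1} ℓ_bⁿ ∈ End(W) · det_n` for any two variables `a, b` of `W = K^{n×n}`, `n ≥ 2`.
[cite: EfremenkoLandsbergSchenckWeyman2018, §5 (Case C3)] -/
theorem X_pow_add_mem_endOrbit (n : ℕ) (hn : 2 ≤ n) (a b : Fin n × Fin n) :
    (X a ^ n + (-1) ^ (n + 1) * X b ^ n : MvPolynomial (Fin n × Fin n) K) ∈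
      endOrbit (Fin n × Fin n) K (Literature.Computability.AlgebraicComplexity.detPoly (Fin n) K) := by
  classical
  rw [← aeval_circulant_detPoly a b n hn]
  exact aeval_option_mem_endOrbit _ _

end Circulant

end Literature.Barriers.ValiantsHypothesis
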